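import Literature.NumberTheory.LFunctions.VinogradovMeanValueCount
import Literature.NumberTheory.LFunctions.VanDerCorputZeta
import HarnessLib

/-!
# Ford's Proposition ZRD, incomplete Vinogradov systems, and the count (5.6)

Topic `Literature/NumberTheory/LFunctions`.  Everything in this file is PROVED; no named fact is
introduced (the `def`s are the representation numbers, the restricted power sums and the
incomplete-system count `J_{s,k,h}`).

K. Ford, *Vinogradov's integral and bounds for the Riemann zeta function*, Proc. LMS 85 (2002):

* `FordVK.zrd` — **Proposition ZRD** ("zero representation dominates", §2): for functions
  `f : B → G` into an abelian group and any `w`, `#{(x,y) ∈ B² : f(x) = f(y) + w} ≤ #{(x,y) : f(x) = f(y)}`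
  (Cauchy–Schwarz on the representation numbers);
* `FordVK.Jinc` — the number `J_{s,k,[h,g]}(ℬ)` of solutions of the *incomplete* system
  `∑_{i≤s} (x_i^j - y_i^j) = 0` (`h ≤ j ≤ g`), `x_i, y_i ∈ ℬ` (Ford (1.8), with the range of
  exponents `[h, g]` of Lemma 5.1), and `FordVK.card_filter_mem_le_Jinc_mul_prod` — the count
  "for each choice of `d_h, …, d_g` the number of `x, y` is `≤ J_{s,g,h}(ℬ)`" used after (5.5);
* `FordVK.card_near_int_le` — **Ford (5.6)**:
  `#{|d| ≤ K : ‖dγ‖ < δ} ≤ 4Kδ + 2Kγ + 4δ/γ + 2`.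

## References

* K. Ford, *Vinogradov's integral and bounds for the Riemann zeta function*, Proc. London Math.
  Soc. (3) 85 (2002), 565–633; arXiv:1910.08209. §2 (Proposition ZRD), (1.8), proof of Lemma 5.1,
  (5.5)–(5.6). [Ford2002]
-/

open Finset

namespace Literature.NumberTheory.LFunctions
namespace FordVK

open VMV

/-! ### Proposition ZRD -/

section ZRD

variable {α G : Type*} [AddCommGroup G] [DecidableEq G]

/-- Representation numbers `n(v) = #{x ∈ B : f(x) = v}`. [cite: Ford2002, §2 (proof of ZRD)] -/
def repG (B : Finset α) (f : α → G) (v : G) : ℕ := (B.filter fun x => f x = v).card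

/-- The number `I(f; w; B)` of solutions of `f(x) - f(y) = w`, `x, y ∈ B`. [cite: Ford2002, §2] -/
def solCount (B : Finset α) (f : α → G) (w : G) : ℕ :=
  ((B ×ˢ B).filter fun xy => f xy.1 = f xy.2 + w).card

/-- `I(f; w; B) = ∑_{y ∈ B} n(f(y) + w)`. [folklore] -/
theorem solCount_eq_sum_rep (B : Finset α) (f : α → G) (w : G) :
    solCount B f w = ∑ y ∈ B, repG B f (f y + w) := by
  unfold solCount repG
  rw [card_filter, sum_product_right]
  refine sum_congr rfl fun y _ => ?_
  rw [card_filter]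

/-- `I(f; w; B) = ∑_{v} n(v + w) n(v)` over the values `v = f(y)`. [folklore] -/
theorem solCount_eq_sum_rep_mul (B : Finset α) (f : α → G) (w : G) :
    solCount B f w = ∑ v ∈ B.image f, repG B f (v + w) * repG B f v := by
  rw [solCount_eq_sum_rep, Finset.sum_comp (s := B) (f := fun v => repG B f (v + w)) (g := f)]
  refine sum_congr rfl fun v _ => ?_
  rw [smul_eq_mul, mul_comm]
  rfl

omit [AddCommGroup G] in
/-- `n(v) = 0` unless `v` is a value of `f` on `B`. [folklore] -/
theorem repG_eq_zero_of_not_mem {B : Finset α} {f : α → G} {v : G} (h : v ∉ B.image f) :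
    repG B f v = 0 := by
  unfold repG
  rw [card_eq_zero, filter_eq_empty_iff]
  intro x hx hx'
  exact h (mem_image.2 ⟨x, hx, hx'⟩)

/-- **Proposition ZRD** (zero representation dominates): `I(f; w; B) ≤ I(f; 0; B)`.
[cite: Ford2002, §2, Proposition ZRD] -/
theorem zrd (B : Finset α) (f : α → G) (w : G) : solCount B f w ≤ solCount B f 0 := by
  set M := B.image f with hM
  have h0 : solCount B f 0 = ∑ v ∈ M, repG B f v * repG B f v := by
    rw [solCount_eq_sum_rep_mul]; simp [hM]
  have h1 : solCount B f w = ∑ v ∈ M, repG B f (v + w) * repG B f v := solCount_eq_sum_rep_mul ..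
  have hshift : ∑ v ∈ M, repG B f (v + w) * repG B f (v + w) ≤ ∑ v ∈ M, repG B f v * repG B f v := by
    have hinj : Set.InjOn (fun v : G => v + w) (M : Set G) := fun a _ b _ h => by simpa using h
    rw [← sum_image (f := fun v => repG B f v * repG B f v) hinj]
    refine sum_le_sum_of_ne_zero fun v _ hne => ?_
    by_contra hvM
    rw [repG_eq_zero_of_not_mem (by rw [← hM]; exact hvM), zero_mul] at hne
    exact hne rfl
  have hkey : 2 * solCount B f w ≤ 2 * solCount B f 0 := by
    rw [h1, h0, mul_sum, mul_sum]
    calc ∑ v ∈ M, 2 * (repG B f (v + w) * repG B f v)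
        ≤ ∑ v ∈ M, (repG B f (v + w) * repG B f (v + w) + repG B f v * repG B f v) := by
          refine sum_le_sum fun v _ => ?_
          nlinarith [sq_nonneg ((repG B f (v + w) : ℤ) - repG B f v)]
      _ = ∑ v ∈ M, repG B f (v + w) * repG B f (v + w) + ∑ v ∈ M, repG B f v * repG B f v :=
          sum_add_distrib
      _ ≤ ∑ v ∈ M, repG B f v * repG B f v + ∑ v ∈ M, repG B f v * repG B f v :=
          Nat.add_le_add_right hshift _
      _ = ∑ v ∈ M, 2 * (repG B f v * repG B f v) := by rw [← two_mul, mul_sum]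
  omega

/-- Fibres of `(x, y) ↦ f(x) - f(y)` are solution counts. [folklore] -/
theorem card_filter_sub_eq (B : Finset α) (f : α → G) (w : G) :
    ((B ×ˢ B).filter fun xy => f xy.1 - f xy.2 = w).card = solCount B f w := by
  unfold solCount
  congr 1
  refine filter_congr fun xy _ => ?_
  rw [sub_eq_iff_eq_add']

/-- **Counting through a box of differences**: if `D ⊆ G` is finite, then
`#{(x,y) ∈ B² : f(x) - f(y) ∈ D} ≤ |D| · I(f; 0; B)`. [cite: Ford2002, proof of Lemma 5.1 ("for
each choice of `d_h, …, d_g`, the number of `x, y` is `≤ J_{s,g,h}(ℬ)`")] -/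
theorem card_filter_sub_mem_le (B : Finset α) (f : α → G) (D : Finset G) :
    ((B ×ˢ B).filter fun xy => f xy.1 - f xy.2 ∈ D).card ≤ D.card * solCount B f 0 := by
  rw [card_eq_sum_card_fiberwise (f := fun xy : α × α => f xy.1 - f xy.2) (t := D)
    (fun xy hxy => by rw [Finset.mem_coe, mem_filter] at hxy; exact hxy.2)]
  calc ∑ d ∈ D, ((B ×ˢ B).filter (fun xy => f xy.1 - f xy.2 ∈ D) |>.filter
          (fun xy => f xy.1 - f xy.2 = d)).card
      ≤ ∑ d ∈ D, solCount B f d := by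
        refine sum_le_sum fun d _ => ?_
        rw [← card_filter_sub_eq]
        exact card_le_card (fun xy hxy => by
          rw [mem_filter] at hxy ⊢; exact ⟨(mem_filter.1 hxy.1).1, hxy.2⟩)
    _ ≤ ∑ _d ∈ D, solCount B f 0 := sum_le_sum fun d _ => zrd B f d
    _ = D.card * solCount B f 0 := by rw [sum_const, smul_eq_mul]

end ZRD

/-! ### Incomplete systems -/

/-- Restricted power sums: the coordinates `j ∈ [h, g]` of `s(x) = (∑_i x_i^j)_j`, the others set to
`0` (`j : Fin k` standing for the exponent `j + 1`). [cite: Ford2002, (1.8)] -/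
def psvR (k h g : ℕ) {s : ℕ} (x : Fin s → ℤ) : Fin k → ℤ :=
  fun j => if h ≤ j.val + 1 ∧ j.val + 1 ≤ g then psv k x j else 0

/-- `J_{s,k,[h,g]}(ℬ)`: the number of solutions of the incomplete system
`∑_{i≤s} x_i^j = ∑_{i ≤ s} y_i^j` (`h ≤ j ≤ g`), `x_i, y_i ∈ ℬ`. For `g = k` this is Ford's
`J_{s,k,h}(ℬ)`. [cite: Ford2002, (1.8) and Lemma 5.1] -/
def Jinc (k s : ℕ) (B : Finset ℤ) (h g : ℕ) : ℕ :=
  solCount (tuples s B) (psvR k h g) 0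

/-- `J_{s,k,[h,g]}(ℬ)` as a filter cardinality. [folklore] -/
theorem Jinc_eq_card (k s : ℕ) (B : Finset ℤ) (h g : ℕ) :
    Jinc k s B h g = ((tuples s B ×ˢ tuples s B).filter
      fun xy => ∀ j : Fin k, h ≤ j.val + 1 → j.val + 1 ≤ g → psv k xy.1 j = psv k xy.2 j).card := by
  unfold Jinc solCount
  congr 1
  refine filter_congr fun xy _ => ?_
  rw [add_zero]
  constructor
  · intro heq j h1 h2
    have := congr_fun heq j
    simp only [psvR, h1, h2, and_self, if_true] at this
    exact this
  · intro hall
    funext j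
    simp only [psvR]
    split_ifs with hj
    · exact hall j hj.1 hj.2
    · rfl

/-- **From a box of differences to `J_{s,k,[h,g]}`**: if for each `j ∈ [h, g]` the difference
`d_j = ∑ x_i^j - ∑ y_i^j` is confined to a finite set `D_j`, the number of such `(x, y)` is at most
`J_{s,k,[h,g]}(ℬ) ∏_{j=h}^{g} |D_j|`. [cite: Ford2002, proof of Lemma 5.1 (after (5.5))] -/
theorem card_filter_mem_le_Jinc_mul_prod (k s : ℕ) (B : Finset ℤ) (h g : ℕ)
    (D : Fin k → Finset ℤ) :
    (((tuples s B ×ˢ tuples s B).filter fun xy => ∀ j : Fin k, h ≤ j.val + 1 → j.val + 1 ≤ g →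
        psv k xy.1 j - psv k xy.2 j ∈ D j).card : ℕ)
      ≤ (∏ j : Fin k, if h ≤ j.val + 1 ∧ j.val + 1 ≤ g then (D j).card else 1) * Jinc k s B h g := by
  classical
  -- the box of restricted difference vectors
  set D' : Fin k → Finset ℤ := fun j => if h ≤ j.val + 1 ∧ j.val + 1 ≤ g then D j else {0} with hD'
  set Box := Fintype.piFinset D' with hBox
  have hcardBox : Box.card = ∏ j : Fin k, if h ≤ j.val + 1 ∧ j.val + 1 ≤ g then (D j).card else 1 := by
    rw [hBox, Fintype.card_piFinset]
    refine prod_congr rfl fun j _ => ?_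
    rw [hD']; simp only; split_ifs <;> simp
  rw [← hcardBox]
  refine le_trans (card_le_card ?_) (card_filter_sub_mem_le (tuples s B) (psvR k h g) Box)
  intro xy hxy
  rw [mem_filter] at hxy ⊢
  refine ⟨hxy.1, ?_⟩
  rw [hBox, Fintype.mem_piFinset]
  intro j
  rw [hD']
  simp only [psvR, Pi.sub_apply]
  split_ifs with hj
  · exact hxy.2 j hj.1 hj.2
  · simp

/-- The complete count dominates: `J_{s,k,[h,g]}(ℬ) ≥ 0` and for `[h,g] = [1,k]` it is `VMV.J`.
[folklore] -/
theorem Jinc_one_eq_J (k s : ℕ) (B : Finset ℤ) : Jinc k s B 1 k = J k s B := by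
  rw [Jinc_eq_card]
  unfold J Jc
  congr 1
  refine filter_congr fun xy _ => ?_
  rw [add_zero]
  constructor
  · intro hall; funext j; exact hall j (by omega) (by omega)
  · intro heq j _ _; rw [heq]

/-! ### The count (5.6) -/

/-- **Ford (5.6)**: for `δ, γ > 0` and `K ≥ 0`,
`#{d ∈ ℤ : |d| ≤ K, ‖dγ‖ < δ} ≤ 4Kδ + 2Kγ + 4δ/γ + 2`, `‖·‖` the distance to the nearest integer.
[cite: Ford2002, (5.6)] -/
theorem card_near_int_le {K γ δ : ℝ} (hK : 0 ≤ K) (hγ : 0 < γ) (hδ : 0 < δ) (S : Finset ℤ)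
    (hS : ∀ d ∈ S, |(d : ℝ)| ≤ K ∧ |d * γ - round (d * γ)| < δ) :
    (S.card : ℝ) ≤ 4 * K * δ + 2 * K * γ + 4 * δ / γ + 2 := by
  classical
  -- fibre over the nearest integer `m = round(dγ)`
  set M₀ : ℕ := ⌊K * γ + 1 / 2⌋₊ with hM₀
  have hmem : ∀ d ∈ S, round ((d : ℝ) * γ) ∈ Finset.Icc (-(M₀ : ℤ)) M₀ := by
    intro d hd
    have h1 := (hS d hd).1
    have hr : |(d : ℝ) * γ - round ((d : ℝ) * γ)| ≤ 1 / 2 := abs_sub_round _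
    have hdγ : |(d : ℝ) * γ| ≤ K * γ := by rw [abs_mul, abs_of_pos hγ]; exact mul_le_mul_of_nonneg_right h1 hγ.le
    have hm : |((round ((d : ℝ) * γ) : ℤ) : ℝ)| ≤ K * γ + 1 / 2 := by
      have := abs_sub_abs_le_abs_sub ((round ((d : ℝ) * γ) : ℤ) : ℝ) ((d : ℝ) * γ)
      rw [abs_sub_comm] at hr
      linarith
    have hm' : |round ((d : ℝ) * γ)| ≤ (M₀ : ℤ) := by
      have h2 : ((|round ((d : ℝ) * γ)| : ℤ) : ℝ) ≤ K * γ + 1 / 2 := by push_cast; exact hm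
      have h3 : |round ((d : ℝ) * γ)| ≤ ⌊K * γ + 1 / 2⌋ := Int.le_floor.2 h2
      have h4 : (⌊K * γ + 1 / 2⌋ : ℤ) = (M₀ : ℤ) := by
        rw [hM₀, Int.natCast_floor_eq_floor]
        positivity
      rw [← h4]; exact h3
    rw [Finset.mem_Icc, ← abs_le]
    exact hm'
  rw [card_eq_sum_card_fiberwise (f := fun d : ℤ => round ((d : ℝ) * γ))
      (t := Finset.Icc (-(M₀ : ℤ)) M₀) (fun d hd => hmem d hd), Nat.cast_sum]
  -- each fibre has diameter `< 2δ/γ`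
  have hfib : ∀ m ∈ Finset.Icc (-(M₀ : ℤ)) M₀,
      ((S.filter fun d : ℤ => round ((d : ℝ) * γ) = m).card : ℝ) ≤ 2 * δ / γ + 1 := by
    intro m _
    refine VdC.card_le_of_diam (R := 2 * δ / γ) (by positivity) fun d₁ hd₁ d₂ hd₂ h12 => ?_
    rw [mem_filter] at hd₁ hd₂
    have e1 := (hS d₁ hd₁.1).2
    have e2 := (hS d₂ hd₂.1).2
    rw [hd₁.2] at e1
    rw [hd₂.2] at e2
    rw [abs_lt] at e1 e2
    have : ((d₂ : ℝ) - d₁) * γ < 2 * δ := by nlinarith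
    rw [le_div_iff₀ hγ]
    linarith
  calc ∑ m ∈ Finset.Icc (-(M₀ : ℤ)) M₀, ((S.filter fun d : ℤ => round ((d : ℝ) * γ) = m).card : ℝ)
      ≤ ∑ _m ∈ Finset.Icc (-(M₀ : ℤ)) M₀, (2 * δ / γ + 1) := sum_le_sum hfib
    _ = ((Finset.Icc (-(M₀ : ℤ)) M₀).card : ℝ) * (2 * δ / γ + 1) := by rw [sum_const, nsmul_eq_mul]
    _ ≤ (2 * K * γ + 2) * (2 * δ / γ + 1) := by
        refine mul_le_mul_of_nonneg_right ?_ (by positivity)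
        have hc : ((Finset.Icc (-(M₀ : ℤ)) M₀).card : ℝ) = 2 * M₀ + 1 := by
          rw [Int.card_Icc]
          rw [show (M₀ : ℤ) + 1 - -(M₀ : ℤ) = ((2 * M₀ + 1 : ℕ) : ℤ) by push_cast; ring, Int.toNat_natCast]
          push_cast; ring
        rw [hc]
        have hM₀le : (M₀ : ℝ) ≤ K * γ + 1 / 2 := Nat.floor_le (by positivity)
        linarith
    _ = 4 * K * δ + 2 * K * γ + 4 * δ / γ + 2 := by field_simp; ring

end FordVK
end Literature.NumberTheory.LFunctions
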